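import Summits.ValiantsHypothesis.ValiantsHypothesis.Theorems.LacunarySymmetroidMatrixDescartesPivotRankOneCriticalWindowsLoneRequiredWeight
import Summits.ValiantsHypothesis.ValiantsHypothesis.Theorems.LacunarySymmetroidMatrixDescartesPivotRankOneCriticalWindowsThreeFence

/-!
# `MatrixDescartes` census — rank-one `(2,K)₁`: THE FASTEST-LONE-LETTER LAW FOR ANY NUMBER OF LETTERS
# (at most two critical directions beyond the pivot letter, for every weight vector)

HONEST FRAMING.  Object-search cell `pub-symmetroid`, seat `val-sym-mdr-p1` (generation 24); helper file `--supports` the crux item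
stmt-ValiantsHypothesis-18050 (`Theses.LacunarySymmetroid.MatrixDescartes`, OPEN, on HOLD) with NO closure claim.  This file assembles the
all-`K` chain `…LoneCubicMoment` → `…LoneFoldCubic` → `…LoneFoldAlgebra` → `…LoneBranch` → `…LoneRequiredWeight` into the `K`-letter analogue of
`…FourFoldCubic.lone_letter_four_right` (generation 23) and `…ThreeLoneLetterCount.lone_letter_three_right` (generation 22): a COUNT for the
lone-side cells of the rank-one `(2,K)₁` row in which the lone letter carries the largest rate.  The row's registers, the other splits,
`MatrixDescartes` in its window, `DoorA26`/`DoorA34`, credences and `VP ≠ VNP` are untouched.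

THE STATEMENT (`lone_letter_right`).  Letters `m ∈ s` (a `Finset`, any size): a pivot `p` (rate `βₚ < 0`, position `tₚ`), left letters
`m ∉ {p, j}` (at least one; rates `βₘ > 0`, positions `0 < tₘ < tₚ`), and ONE lone letter `j` beyond the pivot (`tⱼ > tₚ`) with the LARGEST rate
(`βₘ < βⱼ` for `m ≠ j`); natural exponents coupled as in the pencil, `dₘ − dₚ = λ(βₘ − βₚ)` with `λ > 0`; ANY positive weights `wₘ`.  Then there
are no three critical points `(x₁,T₁), (x₂,T₂), (x₃,T₃)` (`xᵢ > 0`, both critical equations `∑ wₘxᵢ^{dₘ}(Tᵢ²−tₘ²) = 0`,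
`∑ βₘwₘxᵢ^{dₘ}(Tᵢ−tₘ)² = 0`) with `tₚ < T₁ < T₂ < T₃`: the window profile has at most two critical directions beyond the pivot, hence at most
ONE local maximum of the ψ-profile on the lone side.

ANY RATES.  The assembly is proved ONCE as `lone_letter_right_of_foldCubic_pos`: the lone letter need NOT be the fastest; the only input
that still uses «fastest» is the cubic fold inequality, taken there as the hypothesis `hC` (for a fastest lone letter it is
`…LoneFoldCubic.foldCubic_pos`; for other rates it is located — seat numerics `exp/lonek*.py` — not proved).  `S₁ < 0` holds for any rates
(`…LoneRequiredWeight.firstMoment_neg`).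

THE PROOF (memo MOMENT-FOLD.md; all ingredients kernel, all `K`).  (1) Every critical direction beyond the pivot lies in the strict window
`(Tₘ, tⱼ)` (`window_of_critical`, `Three.rightEdge_exists`).  (2) On the window the branch function `φ` of `…LoneBranch` is the unique scale
solving the `j`-free combination, and (E1) forces the lone weight `ω(T) = (∑_{m≠j} wₘφ^{dₘ}(T²−tₘ²))/(φ^{dⱼ}(tⱼ²−T²)) > 0`; three critical
directions make `ω` take the value `wⱼ` three times.  (3) Rolle: `ω′` vanishes at `k₁ < k₂`; by `omegaDeriv_eq` + `foldDenominator_pos` the index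
form `𝒥` vanishes there.  (4) At every zero of `𝒥` on the window: `ω′ = 0`, and `S₂²·𝒥′ = 2S₁·𝒞_W` (`indexFormDeriv_eq_cubic`) with `S₁ < 0`
(`mixedMoment_neg_of_fastest`) and `𝒞_W > 0` (`foldCubic_pos`, ALL `K`) — so `𝒥′ < 0`; the one-zero lemma gives `k₁ = k₂`, contradiction.
[folklore] Calculus bookkeeping.  No definitions, no named facts, no hypotheses beyond the configuration.
-/

-- `Summit.ValiantsHypothesis.ValiantsHypothesis.…` repeats a component by the D-0017 layout
-- (single-conjunct summit), which the `dupNamespace` linter flags; the name is mandated.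
set_option linter.dupNamespace false

open Filter Topology Set

namespace Summit.ValiantsHypothesis.ValiantsHypothesis.Theorems.LacunarySymmetroidMatrixDescartes.Pivot.CriticalWindows.Lone

open Finset
open scoped BigOperators

/-! ## The lone-letter law -/

set_option maxHeartbeats 4000000 in
-- one long assembly (windows, the branch, the lone weight, Rolle twice, the one-zero lemma) over `Finset` sums
/-- **THE LONE-LETTER LAW MODULO THE CUBIC FOLD INEQUALITY — ANY RATES, ANY NUMBER OF LETTERS (right side).**  Pivot `p`, left letters at
`0 < tₘ < tₚ` with positive rates, ONE lone letter `j` at `tⱼ > tₚ` with positive rate (NOT necessarily the largest), pencil-coupled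
exponents, any positive weights.  HYPOTHESIS `hC`: the cubic fold form `𝒞_W` is positive at every point `T ∈ (tₚ, tⱼ)` and every positive
weight vector `W` on the letters satisfying (E1), (E2) and the fold relation (for the lone letter FASTEST this is
`…LoneFoldCubic.foldCubic_pos`; in general it is located, not proved).  CONCLUSION: no three critical points with `tₚ < T₁ < T₂ < T₃`.
The sign `S₁ < 0` needed by the argument holds for any rates (`…LoneRequiredWeight.firstMoment_neg`). [folklore] -/
theorem lone_letter_right_of_foldCubic_pos {ι : Type*} (s : Finset ι) (β t w : ι → ℝ) (d : ι → ℕ) (p j : ι) (lam : ℝ)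
    (hp : p ∈ s) (hj : j ∈ s) (hpj : p ≠ j) (hleft : ∃ m ∈ s, m ≠ p ∧ m ≠ j)
    (hw : ∀ m ∈ s, 0 < w m) (hβp : β p < 0) (hβ : ∀ m ∈ s, m ≠ p → 0 < β m)
    (ht : ∀ m ∈ s, 0 < t m) (htp : ∀ m ∈ s, m ≠ p → m ≠ j → t m < t p) (hpj' : t p < t j)
    (hlam : 0 < lam) (hd : ∀ m ∈ s, (d m : ℝ) - (d p : ℝ) = lam * (β m - β p))
    (hC : ∀ (T : ℝ) (W : ι → ℝ), t p < T → T < t j → (∀ m ∈ s, 0 < W m) →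
      ∑ m ∈ s, W m * (T ^ 2 - t m ^ 2) = 0 → ∑ m ∈ s, β m * W m * (T - t m) ^ 2 = 0 →
      (∑ m ∈ s, W m) * (∑ m ∈ s, β m ^ 2 * W m * (T - t m) ^ 2) = 2 * (∑ m ∈ s, β m * W m * (T - t m)) ^ 2 →
      0 < 3 * (∑ m ∈ s, β m * W m) * (∑ m ∈ s, β m ^ 2 * W m * (T - t m) ^ 2) ^ 2
          - 6 * (∑ m ∈ s, β m ^ 2 * W m * (T - t m)) * (∑ m ∈ s, β m * W m * (T - t m)) * (∑ m ∈ s, β m ^ 2 * W m * (T - t m) ^ 2)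
          + 2 * (∑ m ∈ s, β m ^ 3 * W m * (T - t m) ^ 2) * (∑ m ∈ s, β m * W m * (T - t m)) ^ 2)
    {x₁ x₂ x₃ T₁ T₂ T₃ : ℝ} (hx₁ : 0 < x₁) (hx₂ : 0 < x₂) (hx₃ : 0 < x₃)
    (h01 : t p < T₁) (h12 : T₁ < T₂) (h23 : T₂ < T₃)
    (c₁ : ∑ m ∈ s, w m * x₁ ^ d m * (T₁ ^ 2 - t m ^ 2) = 0) (c₁' : ∑ m ∈ s, β m * (w m * x₁ ^ d m) * (T₁ - t m) ^ 2 = 0)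
    (c₂ : ∑ m ∈ s, w m * x₂ ^ d m * (T₂ ^ 2 - t m ^ 2) = 0) (c₂' : ∑ m ∈ s, β m * (w m * x₂ ^ d m) * (T₂ - t m) ^ 2 = 0)
    (c₃ : ∑ m ∈ s, w m * x₃ ^ d m * (T₃ ^ 2 - t m ^ 2) = 0) (c₃' : ∑ m ∈ s, β m * (w m * x₃ ^ d m) * (T₃ - t m) ^ 2 = 0) :
    False := by
  classical
  -- (0) constants
  have htp0 : 0 < t p := ht p hp
  have hβj : 0 < β j := hβ j hj hpj.symm
  have ha : 0 < -β p := by linarith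
  set κ : ℝ := (d p : ℝ) - lam * β p with hκ
  have hd' : ∀ m ∈ s, (d m : ℝ) = κ + lam * β m := by
    intro m hm; have := hd m hm; rw [hκ]; linarith
  have hdlt : ∀ m ∈ s, m ≠ p → d p < d m := by
    intro m hm hmp
    have h1 : 0 < lam * (β m - β p) := mul_pos hlam (by linarith [hβ m hm hmp])
    have h2 : (d p : ℝ) < d m := by linarith [hd m hm]
    exact_mod_cast h2
  have htp' : ∀ m ∈ s, m ≠ p → m ≠ j → t m ≤ t p := fun m hm hmp hmj => (htp m hm hmp hmj).le
  have hltT : ∀ T : ℝ, t p < T → ∀ m ∈ s, m ≠ j → t m < T := by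
    intro T hT m hm hmj
    by_cases hmp : m = p
    · rw [hmp]; exact hT
    · exact lt_trans (htp m hm hmp hmj) hT
  -- (1) windows and the left edge `Tm`
  have win : ∀ x T : ℝ, 0 < x → t p < T → ∑ m ∈ s, w m * x ^ d m * (T ^ 2 - t m ^ 2) = 0 →
      ∑ m ∈ s, β m * (w m * x ^ d m) * (T - t m) ^ 2 = 0 →
      T < t j ∧ β j * (T + t p) * (t j - T) < (-β p) * (T - t p) * (t j + T) := by
    intro x T hx hT e1 e2
    exact window_of_critical s β t (fun m => w m * x ^ d m) T p j hp hj hpj hleft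
      (fun m hm => mul_pos (hw m hm) (pow_pos hx _)) hβp hβ ht (hltT T hT) e1 e2
  obtain ⟨Tm, hTm0, hTmj, hroot, hQpos, hQi, -⟩ := Three.rightEdge_exists ha hβj htp0 hpj'
  have above : ∀ T : ℝ, t p < T → β j * (T + t p) * (t j - T) < (-β p) * (T - t p) * (t j + T) → Tm < T := by
    intro T hT hw'
    by_contra hcon
    push Not at hcon
    have e : (-β p) * (T + t j) * (T - t p) = (-β p) * (T - t p) * (t j + T) := by ring
    rcases eq_or_lt_of_le hcon with heq | hlt
    · rw [heq] at hw'; rw [heq] at e; linarith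
    · have := hQpos T (by linarith) hlt
      linarith
  have hwinT : ∀ T : ℝ, Tm < T → β j * (T + t p) * (t j - T) < (-β p) * (T - t p) * (t j + T) := by
    intro T hT
    have := hQi T hT
    have e : (-β p) * (T + t j) * (T - t p) = (-β p) * (T - t p) * (t j + T) := by ring
    linarith
  -- (2) the branch function
  obtain ⟨φ, hφ, huniq, hder⟩ := branch_hasDerivAt s β t w d p j Tm hp hleft hw hdlt
    (fun T h1 h2 => minorN_pivot_neg (lt_trans hTm0 h1) h2 (hwinT T h1))
    (fun T h1 h2 m hm hmp hmj => minorN_pos (hβ m hm hmp) hβj (ht m hm) (hltT T (lt_trans hTm0 h1) m hm hmj) h2)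
  -- (3) the required weight
  obtain ⟨ω, hωdef⟩ : ∃ ω : ℝ → ℝ, ∀ T : ℝ, ω T =
      (∑ m ∈ s.erase j, w m * φ T ^ d m * (T ^ 2 - t m ^ 2)) / (φ T ^ d j * (t j ^ 2 - T ^ 2)) :=
    ⟨fun T => (∑ m ∈ s.erase j, w m * φ T ^ d m * (T ^ 2 - t m ^ 2)) / (φ T ^ d j * (t j ^ 2 - T ^ 2)), fun T => rfl⟩
  have hN : ∀ T : ℝ, Tm < T → T < t j → 0 < ∑ m ∈ s.erase j, w m * φ T ^ d m * (T ^ 2 - t m ^ 2) := by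
    intro T h1 h2
    have hφpos := (hφ T h1 h2).1
    obtain ⟨m₀, hm₀, hm₀p, hm₀j⟩ := hleft
    refine Finset.sum_pos' ?_ ⟨m₀, Finset.mem_erase.mpr ⟨hm₀j, hm₀⟩, ?_⟩
    · intro m hm
      have hm' := Finset.mem_of_mem_erase hm
      have hlt := hltT T (lt_trans hTm0 h1) m hm' (Finset.ne_of_mem_erase hm)
      have h0 := ht m hm'
      exact mul_nonneg (mul_nonneg (hw m hm').le (pow_nonneg hφpos.le _)) (by nlinarith)
    · have hlt := hltT T (lt_trans hTm0 h1) m₀ hm₀ hm₀j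
      have h0 := ht m₀ hm₀
      exact mul_pos (mul_pos (hw m₀ hm₀) (pow_pos hφpos _)) (by nlinarith)
  have hD : ∀ T : ℝ, Tm < T → T < t j → 0 < φ T ^ d j * (t j ^ 2 - T ^ 2) := by
    intro T h1 h2
    have hφpos := (hφ T h1 h2).1
    have hT : 0 < T := by linarith
    exact mul_pos (pow_pos hφpos _) (by nlinarith)
  have hωpos : ∀ T : ℝ, Tm < T → T < t j → 0 < ω T := by
    intro T h1 h2; rw [hωdef]; exact div_pos (hN T h1 h2) (hD T h1 h2)
  -- (E1) along the branch
  have hE1 : ∀ T : ℝ, Tm < T → T < t j →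
      ∑ m ∈ s, (Function.update w j (ω T) m * φ T ^ d m) * (T ^ 2 - t m ^ 2) = 0 := by
    intro T h1 h2
    rw [sum_update_split s w _ _ j (ω T) hj, hωdef]
    have hφne : φ T ^ d j ≠ 0 := pow_ne_zero _ (ne_of_gt (hφ T h1 h2).1)
    have hAne : t j ^ 2 - T ^ 2 ≠ 0 := by
      have hT : 0 < T := by linarith
      exact ne_of_gt (by nlinarith)
    have key : (∑ m ∈ s.erase j, w m * φ T ^ d m * (T ^ 2 - t m ^ 2)) / (φ T ^ d j * (t j ^ 2 - T ^ 2))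
        * φ T ^ d j * (T ^ 2 - t j ^ 2) = -(∑ m ∈ s.erase j, w m * φ T ^ d m * (T ^ 2 - t m ^ 2)) := by
      field_simp
      ring
    rw [key]
    ring
  -- (E2) along the branch, from the `j`-free combination
  have hE2 : ∀ T : ℝ, Tm < T → T < t j →
      ∑ m ∈ s, β m * (Function.update w j (ω T) m * φ T ^ d m) * (T - t m) ^ 2 = 0 := by
    intro T h1 h2
    have hAj : T ^ 2 - t j ^ 2 ≠ 0 := by
      have hT : 0 < T := by linarith
      exact ne_of_lt (by nlinarith)
    refine critSecond_of_jfree s β t (fun m => Function.update w j (ω T) m * φ T ^ d m) T j hAj ?_ (hE1 T h1 h2)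
    rw [sum_update_of_zero s w (fun m => φ T ^ d m) _ j (ω T) hj (minorN_lone β t T j)]
    exact (hφ T h1 h2).2
  -- (4) every critical point beyond the pivot lies on the branch and requires the weight `ω`
  have onb : ∀ x T : ℝ, 0 < x → t p < T → ∑ m ∈ s, w m * x ^ d m * (T ^ 2 - t m ^ 2) = 0 →
      ∑ m ∈ s, β m * (w m * x ^ d m) * (T - t m) ^ 2 = 0 → Tm < T ∧ T < t j ∧ ω T = w j := by
    intro x T hx hT e1 e2
    obtain ⟨hTj, hw'⟩ := win x T hx hT e1 e2
    have hTm : Tm < T := above T hT hw'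
    have hF : ∑ m ∈ s, w m * x ^ d m *
        (β j * (T - t j) ^ 2 * (T ^ 2 - t m ^ 2) - (T ^ 2 - t j ^ 2) * β m * (T - t m) ^ 2) = 0 := by
      have := jfree_combination s β t (fun m => w m * x ^ d m) T j
      rw [this, e1, e2, mul_zero, mul_zero, sub_zero]
    have hxφ : x = φ T := huniq T x hTm hTj hx hF
    refine ⟨hTm, hTj, ?_⟩
    rw [hωdef, ← hxφ]
    have hDne : x ^ d j * (t j ^ 2 - T ^ 2) ≠ 0 := by
      have hT0 : 0 < T := by linarith
      exact mul_ne_zero (pow_ne_zero _ hx.ne') (ne_of_gt (by nlinarith))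
    rw [div_eq_iff hDne]
    have hsplit := Finset.sum_erase_add s (fun m => w m * x ^ d m * (T ^ 2 - t m ^ 2)) hj
    linear_combination hsplit + e1
  obtain ⟨hTm1, hT1j, hω1⟩ := onb x₁ T₁ hx₁ h01 c₁ c₁'
  obtain ⟨hTm2, hT2j, hω2⟩ := onb x₂ T₂ hx₂ (by linarith) c₂ c₂'
  obtain ⟨hTm3, hT3j, hω3⟩ := onb x₃ T₃ hx₃ (by linarith) c₃ c₃'
  -- (5) differentiability of `ω`
  have hωfun : ω = fun T' => (∑ m ∈ s.erase j, w m * φ T' ^ d m * (T' ^ 2 - t m ^ 2)) / (φ T' ^ d j * (t j ^ 2 - T' ^ 2)) :=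
    funext hωdef
  have hdiffω : ∀ T : ℝ, Tm < T → T < t j → DifferentiableAt ℝ ω T := by
    intro T h1 h2
    obtain ⟨-, hφd⟩ := hder T h1 h2
    have hNd : HasDerivAt (fun T' : ℝ => ∑ m ∈ s.erase j, w m * φ T' ^ d m * (T' ^ 2 - t m ^ 2))
        (∑ m ∈ s.erase j, (w m * ((d m : ℝ) * φ T ^ (d m - 1) * _) * (T ^ 2 - t m ^ 2) + w m * φ T ^ d m * (2 * T))) T :=
      HasDerivAt.fun_sum fun m _ => ((hφd.fun_pow (d m)).const_mul (w m)).fun_mul (Four.hasDerivAt_sq_sub (t m) T).1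
    have hAj : HasDerivAt (fun T' : ℝ => t j ^ 2 - T' ^ 2) (-(2 * T)) T := by
      simpa using (hasDerivAt_pow 2 T).const_sub (t j ^ 2)
    have hDd := (hφd.fun_pow (d j)).fun_mul hAj
    rw [hωfun]
    exact (hNd.fun_div hDd (ne_of_gt (hD T h1 h2))).differentiableAt
  -- (6) Rolle twice
  have rolle : ∀ P Q : ℝ, Tm < P → P < Q → Q < t j → ω P = ω Q → ∃ cc ∈ Ioo P Q, deriv ω cc = 0 := by
    intro P Q hP hPQ hQ hPQe
    have hcont : ContinuousOn ω (Icc P Q) := fun T hT =>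
      ((hdiffω T (by linarith [hT.1]) (by linarith [hT.2])).continuousAt).continuousWithinAt
    exact exists_hasDerivAt_eq_zero hPQ hcont hPQe
      (fun T hT => (hdiffω T (by linarith [hT.1]) (by linarith [hT.2])).hasDerivAt)
  obtain ⟨k₁, hk₁, hk₁0⟩ := rolle T₁ T₂ hTm1 h12 hT2j (by rw [hω1, hω2])
  obtain ⟨k₂, hk₂, hk₂0⟩ := rolle T₂ T₃ hTm2 h23 hT3j (by rw [hω2, hω3])
  -- (7) raw derivatives of the two critical expressions vanish along the branch
  have hraw : ∀ T : ℝ, Tm < T → T < t j → ∀ XP OP : ℝ, HasDerivAt φ XP T → HasDerivAt ω OP T →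
      ((∑ m ∈ s, (Function.update w j (ω T) m * ((d m : ℝ) * φ T ^ (d m - 1) * XP) * (T ^ 2 - t m ^ 2)
          + Function.update w j (ω T) m * φ T ^ d m * (2 * T))) + OP * φ T ^ d j * (T ^ 2 - t j ^ 2) = 0) ∧
      ((∑ m ∈ s, (Function.update w j (ω T) m * ((d m : ℝ) * φ T ^ (d m - 1) * XP) * (β m * (T - t m) ^ 2)
          + Function.update w j (ω T) m * φ T ^ d m * (β m * (2 * (T - t m))))) + OP * φ T ^ d j * (β j * (T - t j) ^ 2) = 0) := by
    intro T h1 h2 XP OP hφd hωd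
    have hd1 := hasDerivAt_branchSum s w d j hj (fun m T' => T' ^ 2 - t m ^ 2) (fun _ => 2 * T) hφd hωd
      (fun m _ => (Four.hasDerivAt_sq_sub (t m) T).1)
    have hd2 := hasDerivAt_branchSum s w d j hj (fun m T' => β m * (T' - t m) ^ 2) (fun m => β m * (2 * (T - t m))) hφd hωd
      (fun m _ => ((Four.hasDerivAt_sq_sub (t m) T).2).const_mul (β m))
    have hev1 : (fun T' : ℝ => ∑ m ∈ s, Function.update w j (ω T') m * φ T' ^ d m * (T' ^ 2 - t m ^ 2)) =ᶠ[𝓝 T]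
        fun _ => (0 : ℝ) := by
      filter_upwards [Ioo_mem_nhds h1 h2] with T' hT'
      exact hE1 T' hT'.1 hT'.2
    have hev2 : (fun T' : ℝ => ∑ m ∈ s, Function.update w j (ω T') m * φ T' ^ d m * (β m * (T' - t m) ^ 2)) =ᶠ[𝓝 T]
        fun _ => (0 : ℝ) := by
      filter_upwards [Ioo_mem_nhds h1 h2] with T' hT'
      have := hE2 T' hT'.1 hT'.2
      rw [← this]
      exact Finset.sum_congr rfl fun m _ => by ring
    have z1 := (hasDerivAt_const T (0 : ℝ)).congr_of_eventuallyEq hev1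
    have z2 := (hasDerivAt_const T (0 : ℝ)).congr_of_eventuallyEq hev2
    exact ⟨hd1.unique z1, hd2.unique z2⟩
  -- positivity of the branch weights
  have hWpos : ∀ T : ℝ, Tm < T → T < t j → ∀ m ∈ s, 0 < Function.update w j (ω T) m * φ T ^ d m := by
    intro T h1 h2 m hm
    have hp' := (hφ T h1 h2).1
    by_cases hmj : m = j
    · rw [hmj, Function.update_self]; exact mul_pos (hωpos T h1 h2) (pow_pos hp' _)
    · rw [Function.update_of_ne hmj]; exact mul_pos (hw m hm) (pow_pos hp' _)
  -- the fold denominator is positive along the branch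
  have hDpos : ∀ T : ℝ, Tm < T → T < t j →
      0 < β j * (T - t j) ^ 2 * (∑ m ∈ s, β m * (Function.update w j (ω T) m * φ T ^ d m) * (T ^ 2 - t m ^ 2))
        + (t j ^ 2 - T ^ 2) * ∑ m ∈ s, β m ^ 2 * (Function.update w j (ω T) m * φ T ^ d m) * (T - t m) ^ 2 := by
    intro T h1 h2
    exact foldDenominator_pos s β t (fun m => Function.update w j (ω T) m * φ T ^ d m) T p j hp hpj (hWpos T h1 h2) hβp hβ ht
      (hltT T (lt_trans hTm0 h1)) h2 hβj (hwinT T h1)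
  -- (8) the index form along the branch
  obtain ⟨J, hJdef⟩ : ∃ J : ℝ → ℝ, ∀ T' : ℝ, J T' =
      2 * (∑ m ∈ s, Function.update w j (ω T') m * φ T' ^ d m * (β m * (T' - t m))) ^ 2
        - (∑ m ∈ s, Function.update w j (ω T') m * φ T' ^ d m * (1:ℝ))
          * (∑ m ∈ s, Function.update w j (ω T') m * φ T' ^ d m * (β m ^ 2 * (T' - t m) ^ 2)) :=
    ⟨fun T' => 2 * (∑ m ∈ s, Function.update w j (ω T') m * φ T' ^ d m * (β m * (T' - t m))) ^ 2
        - (∑ m ∈ s, Function.update w j (ω T') m * φ T' ^ d m * (1:ℝ))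
          * (∑ m ∈ s, Function.update w j (ω T') m * φ T' ^ d m * (β m ^ 2 * (T' - t m) ^ 2)), fun T' => rfl⟩
  have hJfun : J = fun T' => 2 * (∑ m ∈ s, Function.update w j (ω T') m * φ T' ^ d m * (β m * (T' - t m))) ^ 2
        - (∑ m ∈ s, Function.update w j (ω T') m * φ T' ^ d m * (1:ℝ))
          * (∑ m ∈ s, Function.update w j (ω T') m * φ T' ^ d m * (β m ^ 2 * (T' - t m) ^ 2)) := funext hJdef
  -- conversions between the `f`-forms and the `W`-forms of the three sums
  have cvS1 : ∀ T : ℝ, ∑ m ∈ s, Function.update w j (ω T) m * φ T ^ d m * (β m * (T - t m))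
      = ∑ m ∈ s, β m * (Function.update w j (ω T) m * φ T ^ d m) * (T - t m) := fun T => Finset.sum_congr rfl fun m _ => by ring
  have cvA : ∀ T : ℝ, ∑ m ∈ s, Function.update w j (ω T) m * φ T ^ d m * (1:ℝ)
      = ∑ m ∈ s, (Function.update w j (ω T) m * φ T ^ d m) := fun T => Finset.sum_congr rfl fun m _ => by ring
  have cvS2 : ∀ T : ℝ, ∑ m ∈ s, Function.update w j (ω T) m * φ T ^ d m * (β m ^ 2 * (T - t m) ^ 2)
      = ∑ m ∈ s, β m ^ 2 * (Function.update w j (ω T) m * φ T ^ d m) * (T - t m) ^ 2 :=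
    fun T => Finset.sum_congr rfl fun m _ => by ring
  have hJW : ∀ T : ℝ, J T = 2 * (∑ m ∈ s, β m * (Function.update w j (ω T) m * φ T ^ d m) * (T - t m)) ^ 2
      - (∑ m ∈ s, (Function.update w j (ω T) m * φ T ^ d m))
        * ∑ m ∈ s, β m ^ 2 * (Function.update w j (ω T) m * φ T ^ d m) * (T - t m) ^ 2 := by
    intro T; rw [hJdef, cvS1, cvA, cvS2]
  -- at a zero of `deriv ω`, `J` vanishes, and conversely
  have hJω : ∀ T : ℝ, Tm < T → T < t j → (deriv ω T = 0 ↔ J T = 0) := by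
    intro T h1 h2
    obtain ⟨-, hφd⟩ := hder T h1 h2
    have hωd := (hdiffω T h1 h2).hasDerivAt
    obtain ⟨r1, r2⟩ := hraw T h1 h2 _ _ hφd hωd
    have hX : φ T ≠ 0 := ne_of_gt (hφ T h1 h2).1
    have key := omegaDeriv_eq s β t w d j T (φ T) _ (ω T) (deriv ω T) κ lam hX hd' (hE1 T h1 h2) (hE2 T h1 h2) r1 r2
    have hDp := hDpos T h1 h2
    have hT : 0 < T := by linarith
    have hXd : 0 < φ T ^ d j := pow_pos (hφ T h1 h2).1 _
    rw [hJW]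
    constructor
    · intro h0
      rw [h0, zero_mul, zero_mul] at key
      have : (2 * T * lam) * (2 * (∑ m ∈ s, β m * (Function.update w j (ω T) m * φ T ^ d m) * (T - t m)) ^ 2
          - (∑ m ∈ s, (Function.update w j (ω T) m * φ T ^ d m))
            * ∑ m ∈ s, β m ^ 2 * (Function.update w j (ω T) m * φ T ^ d m) * (T - t m) ^ 2) = 0 := by
        linear_combination key
      rcases mul_eq_zero.mp this with h | h
      · exfalso
        have : 0 < 2 * T * lam := mul_pos (mul_pos two_pos hT) hlam
        linarith
      · exact h
    · intro hJ0
      rw [hJ0, mul_zero] at key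
      have : deriv ω T * (φ T ^ d j * (lam * (β j * (T - t j) ^ 2
          * (∑ m ∈ s, β m * (Function.update w j (ω T) m * φ T ^ d m) * (T ^ 2 - t m ^ 2))
          + (t j ^ 2 - T ^ 2) * ∑ m ∈ s, β m ^ 2 * (Function.update w j (ω T) m * φ T ^ d m) * (T - t m) ^ 2))) = 0 := by
        rw [← key]; ring
      rcases mul_eq_zero.mp this with h | h
      · exact h
      · exfalso
        have : 0 < φ T ^ d j * (lam * (β j * (T - t j) ^ 2
            * (∑ m ∈ s, β m * (Function.update w j (ω T) m * φ T ^ d m) * (T ^ 2 - t m ^ 2))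
            + (t j ^ 2 - T ^ 2) * ∑ m ∈ s, β m ^ 2 * (Function.update w j (ω T) m * φ T ^ d m) * (T - t m) ^ 2)) :=
          mul_pos hXd (mul_pos hlam hDp)
        linarith
  -- (9) `J` is continuous on the window and at each zero has a negative derivative
  have hJdiff : ∀ T : ℝ, Tm < T → T < t j → DifferentiableAt ℝ J T := by
    intro T h1 h2
    obtain ⟨-, hφd⟩ := hder T h1 h2
    have hJd := hasDerivAt_indexForm s β t w d j hj hφd (hdiffω T h1 h2).hasDerivAt
    rw [hJfun]
    exact hJd.differentiableAt
  have hJcont : ContinuousOn J (Ioo Tm (t j)) := fun T hT => ((hJdiff T hT.1 hT.2).continuousAt).continuousWithinAt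
  have hJneg : ∀ z ∈ Ioo Tm (t j), J z = 0 → HasDerivAt J (deriv J z) z ∧ deriv J z < 0 := by
    intro z hz hJz
    obtain ⟨h1, h2⟩ := hz
    refine ⟨(hJdiff z h1 h2).hasDerivAt, ?_⟩
    obtain ⟨hFx, hφd⟩ := hder z h1 h2
    have hω0 : HasDerivAt ω 0 z := by
      have := (hdiffω z h1 h2).hasDerivAt
      rwa [(hJω z h1 h2).2 hJz] at this
    have hJd := hasDerivAt_indexForm s β t w d j hj hφd hω0
    rw [hJfun, hJd.deriv]
    obtain ⟨-, r2⟩ := hraw z h1 h2 _ _ hφd hω0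
    have hX : φ z ≠ 0 := ne_of_gt (hφ z h1 h2).1
    have hWp := hWpos z h1 h2
    have hzj : z ≠ t j := ne_of_lt h2
    have hS₂ : 0 < ∑ m ∈ s, β m ^ 2 * (Function.update w j (ω z) m * φ z ^ d m) * (z - t m) ^ 2 :=
      secondMoment_pos s β t (fun m => Function.update w j (ω z) m * φ z ^ d m) z j hj (fun m hm => (hWp m hm).le)
        (hWp j hj) (ne_of_gt hβj) hzj
    have hfold : (∑ m ∈ s, (Function.update w j (ω z) m * φ z ^ d m))
        * (∑ m ∈ s, β m ^ 2 * (Function.update w j (ω z) m * φ z ^ d m) * (z - t m) ^ 2)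
        = 2 * (∑ m ∈ s, β m * (Function.update w j (ω z) m * φ z ^ d m) * (z - t m)) ^ 2 := by
      have := hJz; rw [hJW] at this; linarith
    have cubic := indexFormDeriv_eq_cubic s β t w d j z (φ z) _ (ω z) κ lam hX (ne_of_gt hlam) hd' (ne_of_gt hS₂)
      (hE2 z h1 h2) r2 hfold
    -- signs: `S₁ < 0` (any rates), `𝒞_W > 0` (hypothesis `hC`)
    have hS₁ : ∑ m ∈ s, β m * (Function.update w j (ω z) m * φ z ^ d m) * (z - t m) < 0 :=
      firstMoment_neg s β t (fun m => Function.update w j (ω z) m * φ z ^ d m) z p j hj hWp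
        (fun m hm hmp => (hβ m hm hmp).le) hβj htp' (lt_trans hTm0 h1) h2 (hE2 z h1 h2)
    have hCW := hC z (fun m => Function.update w j (ω z) m * φ z ^ d m) (lt_trans hTm0 h1) h2 hWp
      (hE1 z h1 h2) (hE2 z h1 h2) hfold
    have h2S1 : 2 * (∑ m ∈ s, β m * (Function.update w j (ω z) m * φ z ^ d m) * (z - t m))
        * (3 * (∑ m ∈ s, β m * (Function.update w j (ω z) m * φ z ^ d m))
              * (∑ m ∈ s, β m ^ 2 * (Function.update w j (ω z) m * φ z ^ d m) * (z - t m) ^ 2) ^ 2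
          - 6 * (∑ m ∈ s, β m ^ 2 * (Function.update w j (ω z) m * φ z ^ d m) * (z - t m))
              * (∑ m ∈ s, β m * (Function.update w j (ω z) m * φ z ^ d m) * (z - t m))
              * (∑ m ∈ s, β m ^ 2 * (Function.update w j (ω z) m * φ z ^ d m) * (z - t m) ^ 2)
          + 2 * (∑ m ∈ s, β m ^ 3 * (Function.update w j (ω z) m * φ z ^ d m) * (z - t m) ^ 2)
              * (∑ m ∈ s, β m * (Function.update w j (ω z) m * φ z ^ d m) * (z - t m)) ^ 2) < 0 :=
      mul_neg_of_neg_of_pos (by linarith) hCW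
    have hlt := cubic.trans_lt h2S1
    by_contra hcon
    push Not at hcon
    exact absurd hlt (not_lt.mpr (mul_nonneg (pow_pos hS₂ 2).le hcon))
  -- (10) the one-zero lemma
  have hk₁J : J k₁ = 0 := (hJω k₁ (by linarith [hk₁.1]) (by linarith [hk₁.2])).1 hk₁0
  have hk₂J : J k₂ = 0 := (hJω k₂ (by linarith [hk₂.1]) (by linarith [hk₂.2])).1 hk₂0
  have heq := Four.eq_of_zeros_of_hasDerivAt_neg hJcont hJneg (z₁ := k₁) (z₂ := k₂)
    ⟨by linarith [hk₁.1], by linarith [hk₁.2]⟩ ⟨by linarith [hk₂.1], by linarith [hk₂.2]⟩ hk₁J hk₂J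
  linarith [hk₁.2, hk₂.1]

/-- **THE FASTEST-LONE-LETTER LAW (any number of letters, right side): AT MOST TWO CRITICAL DIRECTIONS BEYOND THE PIVOT LETTER.**  See the
module docstring: when the lone letter carries the largest rate (`βₘ < βⱼ`, `m ≠ j`) the hypothesis `hC` of
`lone_letter_right_of_foldCubic_pos` is `…LoneFoldCubic.foldCubic_pos`, so the count is unconditional. [folklore] -/
theorem lone_letter_right {ι : Type*} (s : Finset ι) (β t w : ι → ℝ) (d : ι → ℕ) (p j : ι) (lam : ℝ)
    (hp : p ∈ s) (hj : j ∈ s) (hpj : p ≠ j) (hleft : ∃ m ∈ s, m ≠ p ∧ m ≠ j)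
    (hw : ∀ m ∈ s, 0 < w m) (hβp : β p < 0) (hβ : ∀ m ∈ s, m ≠ p → 0 < β m) (hfast : ∀ m ∈ s, m ≠ j → β m < β j)
    (ht : ∀ m ∈ s, 0 < t m) (htp : ∀ m ∈ s, m ≠ p → m ≠ j → t m < t p) (hpj' : t p < t j)
    (hlam : 0 < lam) (hd : ∀ m ∈ s, (d m : ℝ) - (d p : ℝ) = lam * (β m - β p))
    {x₁ x₂ x₃ T₁ T₂ T₃ : ℝ} (hx₁ : 0 < x₁) (hx₂ : 0 < x₂) (hx₃ : 0 < x₃)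
    (h01 : t p < T₁) (h12 : T₁ < T₂) (h23 : T₂ < T₃)
    (c₁ : ∑ m ∈ s, w m * x₁ ^ d m * (T₁ ^ 2 - t m ^ 2) = 0) (c₁' : ∑ m ∈ s, β m * (w m * x₁ ^ d m) * (T₁ - t m) ^ 2 = 0)
    (c₂ : ∑ m ∈ s, w m * x₂ ^ d m * (T₂ ^ 2 - t m ^ 2) = 0) (c₂' : ∑ m ∈ s, β m * (w m * x₂ ^ d m) * (T₂ - t m) ^ 2 = 0)
    (c₃ : ∑ m ∈ s, w m * x₃ ^ d m * (T₃ ^ 2 - t m ^ 2) = 0) (c₃' : ∑ m ∈ s, β m * (w m * x₃ ^ d m) * (T₃ - t m) ^ 2 = 0) :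
    False := by
  have hfast' : ∀ m ∈ s, β m ≤ β j := fun m hm => by
    by_cases hmj : m = j
    · rw [hmj]
    · exact (hfast m hm hmj).le
  have htp' : ∀ m ∈ s, m ≠ p → m ≠ j → t m ≤ t p := fun m hm hmp hmj => (htp m hm hmp hmj).le
  refine lone_letter_right_of_foldCubic_pos s β t w d p j lam hp hj hpj hleft hw hβp hβ ht htp hpj' hlam hd ?_
    hx₁ hx₂ hx₃ h01 h12 h23 c₁ c₁' c₂ c₂' c₃ c₃'
  intro T W hT hTj hW e1 e2 efold
  exact foldCubic_pos s β t W T p j hp hj hpj hleft hW hβp hβ hfast' ht htp' hT hTj e1 e2 efold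

end Summit.ValiantsHypothesis.ValiantsHypothesis.Theorems.LacunarySymmetroidMatrixDescartes.Pivot.CriticalWindows.Lone
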